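import Literature.NumberTheory.EllipticCurves.SelmerCorankProofs
import HarnessLib

/-!
# Crux U1 `KolyvaginBoundedDefectAtTwo` (stmt-BirchSwinnertonDyer-28083), LINE 17 `regular_core_rigidity`,
# toward the START FRAME (N3‴) — the eigen-rank identity `#C[2] = #((1+τ)C)[2] · #((1−τ)C)[2]`

Width seat `bsd-line-krr2-p2` g16 (ONE READER on S1b), landing the pen's (`bsd-idea-1` g12, HOME
`line17/EigenRankIdentity.lean`, sha16 4fd07090297671c3) eigen-rank identity plus its SUBGROUP form, which the
start-frame assembly consumes; `--supports stmt-BirchSwinnertonDyer-28083` (helper). THEOREMS ONLY, pure algebra on top of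
`Literature.NumberTheory.EllipticCurves.SelmerCorankProofs` (`natCard_torsionBy_eq_mul`, `torsionByEquiv`); nothing here
proves the start frame, S1b, U1, a rung or BSD. BSD is NOT proved.

* `natCard_torsionBy_quotient_eq` — `#(M/F)[n] = #M[n]` for `M` `n`-divisible and `F ≤ M` killed by `n`;
* `natCard_torsionBy_eq_quotient_mul` — `#A[p] = #(A/C)[p] · #C[p]` for a `p`-divisible subgroup `C ≤ A`;
* `natCard_torsionBy_two_eq_mul_of_involution` — for an involution `τ` of a `2`-divisible abelian group `M` with `M[2]`
  finite, `#M[2] = #((1−τ)M)[2] · #((1+τ)M)[2]` (`M = (1+τ)M + (1−τ)M` as `m = 2m'`; `(1+τ)M ∩ (1−τ)M ⊆ M[2]`; so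
  `M/(1+τ)M ≅ (1−τ)M / ((1+τ)M ∩ (1−τ)M)` and the first lemma applies);
* `natCard_inf_torsionBy_two_eq_mul_of_involution` — the same for a `τ`-STABLE `2`-DIVISIBLE SUBGROUP `C ≤ A` of a group with
  involution `τ`: `#(C ∩ A[2]) = #((1−τ)C ∩ A[2]) · #((1+τ)C ∩ A[2])`, i.e. `dim C[2] = r₋ + r₊` with `r_±` the eigen-ranks of the
  start eigenframe (`EigenframeFinite.eigenframe_of_divisible_finite_card`). With `A = Sel_{2^∞}(E/K)`, `C` its maximal divisible
  subgroup, `dim C[2] = corank_{ℤ₂} Sel_{2^∞}(E/K)` (`pow_zpCorank_eq_natCard_torsionBy_inf_range_of_stable`), ODD by 2-parity.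
[cite: Greenberg1999, §1–2 (cofinitely generated `ℤ_p`-modules)] [folklore]
Design: no definitions; axioms `propext`, `Classical.choice`, `Quot.sound`.
-/

set_option autoImplicit false
-- the Theorems namespace of this sub repeats the summit name by design (D-0017 nested layout)
set_option linter.dupNamespace false

namespace Summit.BirchSwinnertonDyer.BirchSwinnertonDyer.Theorems.KolyvaginAtTwo.EigenframeFinite

open AddSubgroup Literature.NumberTheory.EllipticCurves

/-- `a ∈ A[n] ↔ n • a = 0`. [folklore] -/
theorem mem_torsionBy_iff' {A : Type*} [AddCommGroup A] (n : ℤ) (a : A) : a ∈ torsionBy A n ↔ n • a = 0 :=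
  Submodule.mem_torsionBy_iff n a

/-- **`#(M/F)[n] = #M[n]`** for `M` `n`-divisible and `F ≤ M` killed by `n` (the multiplication-by-`n` map
`M/F → M` restricted to `(M/F)[n]` has image `F` and kernel `M[n]/F`).  Use in N3‴: `M = (1−τ)C`, `F = (1+τ)C ∩ (1−τ)C ⊆ C[2]`,
`C/(1+τ)C ≅ M/F`, so `#C[2] = #((1+τ)C)[2] · #((1−τ)C)[2]` (`r₊ + r₋ = dim C[2]`). [folklore] -/
theorem natCard_torsionBy_quotient_eq {M : Type*} [AddCommGroup M] (F : AddSubgroup M) (n : ℤ)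
    (hF : ∀ f ∈ F, n • f = 0) (hdiv : ∀ m : M, ∃ m' : M, n • m' = m) [Finite (torsionBy M n)] :
    Nat.card (torsionBy (M ⧸ F) n) = Nat.card (torsionBy M n) := by
  classical
  -- `φ : M ⧸ F →+ M`, `m̄ ↦ n • m`
  have hFker : F ≤ (zsmulAddGroupHom (α := M) n).ker := fun f hf ↦ by
    rw [AddMonoidHom.mem_ker, zsmulAddGroupHom_apply]; exact hF f hf
  set φ : M ⧸ F →+ M := QuotientAddGroup.lift F (zsmulAddGroupHom (α := M) n) hFker with hφ
  have hφmk : ∀ m : M, φ (m : M ⧸ F) = n • m := fun m ↦ by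
    rw [hφ, QuotientAddGroup.lift_mk, zsmulAddGroupHom_apply]
  set S : AddSubgroup (M ⧸ F) := torsionBy (M ⧸ F) n with hS
  set ρ : S →+ M := φ.comp S.subtype with hρ
  -- the range of `ρ` is `F`
  have hrange : ρ.range = F := by
    ext f
    constructor
    · rintro ⟨⟨x, hx⟩, rfl⟩
      induction x using QuotientAddGroup.induction_on with
      | H m =>
        rw [hρ, AddMonoidHom.comp_apply, AddSubgroup.subtype_apply, hφmk]
        have hx' : n • (m : M ⧸ F) = 0 := (mem_torsionBy_iff' n _).mp hx
        rw [← QuotientAddGroup.mk_zsmul, QuotientAddGroup.eq_zero_iff] at hx'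
        exact hx'
    · intro hf
      obtain ⟨m, hm⟩ := hdiv f
      have hmS : (m : M ⧸ F) ∈ S := by
        rw [hS, mem_torsionBy_iff', ← QuotientAddGroup.mk_zsmul, QuotientAddGroup.eq_zero_iff, hm]
        exact hf
      exact ⟨⟨(m : M ⧸ F), hmS⟩, by rw [hρ, AddMonoidHom.comp_apply, AddSubgroup.subtype_apply, hφmk, hm]⟩
  -- the kernel of `ρ` is the image of `M[n]`, with fibres `F`
  set π : torsionBy M n →+ S :=
    { toFun := fun x ↦ ⟨((x : M) : M ⧸ F), by
        rw [hS, mem_torsionBy_iff', ← QuotientAddGroup.mk_zsmul, (mem_torsionBy_iff' n (x : M)).mp x.2,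
          QuotientAddGroup.mk_zero]⟩
      map_zero' := by ext; simp
      map_add' := fun a b ↦ by ext; simp } with hπ
  have hπker : Nat.card π.ker = Nat.card F := by
    refine Nat.card_congr (Equiv.ofBijective (fun x : π.ker ↦ (⟨((x : torsionBy M n) : M), ?_⟩ : F)) ⟨?_, ?_⟩)
    · have hx := x.2
      rw [AddMonoidHom.mem_ker] at hx
      have hx' := congrArg (fun t : S ↦ ((t : M ⧸ F))) hx
      simp only [hπ, AddMonoidHom.coe_mk, ZeroHom.coe_mk, ZeroMemClass.coe_zero] at hx'
      exact (QuotientAddGroup.eq_zero_iff _).mp hx'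
    · intro a b hab
      have := congrArg (fun t : F ↦ (t : M)) hab
      exact Subtype.ext (Subtype.ext this)
    · intro ⟨f, hf⟩
      have hfn : f ∈ torsionBy M n := (mem_torsionBy_iff' n f).mpr (hF f hf)
      refine ⟨⟨⟨f, hfn⟩, ?_⟩, rfl⟩
      rw [AddMonoidHom.mem_ker]
      ext
      simp only [hπ, AddMonoidHom.coe_mk, ZeroHom.coe_mk, ZeroMemClass.coe_zero]
      exact (QuotientAddGroup.eq_zero_iff f).mpr hf
  have hπrange : π.range = ρ.ker := by
    ext ⟨x, hx⟩
    constructor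
    · rintro ⟨y, hy⟩
      rw [AddMonoidHom.mem_ker, hρ, AddMonoidHom.comp_apply, AddSubgroup.subtype_apply, ← hy]
      simp only [hπ, AddMonoidHom.coe_mk, ZeroHom.coe_mk]
      rw [hφmk]
      exact (mem_torsionBy_iff' n (y : M)).mp y.2
    · intro hk
      rw [AddMonoidHom.mem_ker, hρ, AddMonoidHom.comp_apply, AddSubgroup.subtype_apply] at hk
      induction x using QuotientAddGroup.induction_on with
      | H m =>
        rw [hφmk] at hk
        exact ⟨⟨m, (mem_torsionBy_iff' n m).mpr hk⟩, rfl⟩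
  -- count
  have h1 : Nat.card S = Nat.card (S ⧸ ρ.ker) * Nat.card ρ.ker := card_eq_card_quotient_mul_card_addSubgroup _
  have h2 : Nat.card (S ⧸ ρ.ker) = Nat.card F := by
    rw [Nat.card_congr (QuotientAddGroup.quotientKerEquivRange ρ).toEquiv, hrange]
  have h3 : Nat.card (torsionBy M n) = Nat.card (torsionBy M n ⧸ π.ker) * Nat.card π.ker :=
    card_eq_card_quotient_mul_card_addSubgroup _
  have h4 : Nat.card (torsionBy M n ⧸ π.ker) = Nat.card ρ.ker := by
    rw [Nat.card_congr (QuotientAddGroup.quotientKerEquivRange π).toEquiv, hπrange]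
  rw [h1, h2, h3, h4, hπker, mul_comm]


/-- **`#A[p] = #(A/C)[p] · #C[p]`** for a `p`-divisible subgroup `C ≤ A`: the tree's `natCard_torsionBy_eq_mul` along
`0 → C → A → A/C → 0`. [folklore] -/
theorem natCard_torsionBy_eq_quotient_mul {A : Type*} [AddCommGroup A] (C : AddSubgroup A) (p : ℕ)
    (hdiv : ∀ c ∈ C, ∃ c' ∈ C, p • c' = c) :
    Nat.card (torsionBy A (p : ℤ)) = Nat.card (torsionBy (A ⧸ C) (p : ℤ)) * Nat.card (torsionBy C (p : ℤ)) :=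
  natCard_torsionBy_eq_mul (i := C.subtype) (f := QuotientAddGroup.mk' C) C.subtype_injective
    (QuotientAddGroup.mk'_surjective C)
    (fun a ha ↦ by rwa [QuotientAddGroup.mk'_apply, QuotientAddGroup.eq_zero_iff, ← AddSubgroup.range_subtype C] at ha)
    (fun d ↦ by rw [QuotientAddGroup.mk'_apply, QuotientAddGroup.eq_zero_iff]; exact d.2)
    (fun d ↦ by
      obtain ⟨c', hc', h⟩ := hdiv d d.2
      exact ⟨⟨c', hc'⟩, Subtype.ext (by rw [AddSubgroupClass.coe_nsmul]; exact h)⟩)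

/-- **Eigen-rank identity.**  For an involution `τ` of a `2`-divisible abelian group `M` with finite `M[2]`:
`#M[2] = #((1−τ)M)[2] · #((1+τ)M)[2]` (`dim M[2] = r₋ + r₊`).  Proof: `M = (1+τ)M + (1−τ)M` since `m = 2m' = (m'+τm') + (m'−τm')`;
an element of `(1+τ)M ∩ (1−τ)M` is fixed and negated by `τ`, hence killed by `2`; so `M/(1+τ)M ≅ (1−τ)M / ((1+τ)M ∩ (1−τ)M)` has
as many `2`-torsion elements as `(1−τ)M` (`natCard_torsionBy_quotient_eq`), and `#M[2] = #(M/(1+τ)M)[2] · #((1+τ)M)[2]`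
(`natCard_torsionBy_eq_quotient_mul`, `(1+τ)M` being `2`-divisible). [folklore] -/
theorem natCard_torsionBy_two_eq_mul_of_involution {M : Type*} [AddCommGroup M] (τ : M →+ M)
    (hτ : ∀ x, τ (τ x) = x) (hdiv : ∀ m : M, ∃ m' : M, 2 • m' = m)
    [hfin : Finite (torsionBy M ((2 : ℕ) : ℤ))] :
    Nat.card (torsionBy M ((2 : ℕ) : ℤ)) =
      Nat.card (torsionBy (AddMonoidHom.id M - τ).range ((2 : ℕ) : ℤ)) *
        Nat.card (torsionBy (AddMonoidHom.id M + τ).range ((2 : ℕ) : ℤ)) := by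
  classical
  set P : AddSubgroup M := (AddMonoidHom.id M + τ).range with hP
  set Q : AddSubgroup M := (AddMonoidHom.id M - τ).range with hQ
  -- both eigen-images are `2`-divisible
  have hPdiv : ∀ c ∈ P, ∃ c' ∈ P, (2 : ℕ) • c' = c := by
    rintro c ⟨m, rfl⟩
    obtain ⟨m', hm'⟩ := hdiv m
    exact ⟨(AddMonoidHom.id M + τ) m', ⟨m', rfl⟩, by rw [← map_nsmul, hm']⟩
  have hQdiv : ∀ q : Q, ∃ q' : Q, ((2 : ℕ) : ℤ) • q' = q := by
    rintro ⟨c, m, rfl⟩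
    obtain ⟨m', hm'⟩ := hdiv m
    exact ⟨⟨(AddMonoidHom.id M - τ) m', m', rfl⟩, Subtype.ext (by
      rw [natCast_zsmul, AddSubgroupClass.coe_nsmul, ← map_nsmul, hm'])⟩
  -- Step 1: `#M[2] = #(M/P)[2] · #P[2]`
  have h1 := natCard_torsionBy_eq_quotient_mul P 2 hPdiv
  -- Step 2: `Q → M/P` is onto (`M = P + Q`) with kernel `P ∩ Q`, killed by `2`
  let ψ : Q →+ M ⧸ P := (QuotientAddGroup.mk' P).comp Q.subtype
  have hψapply : ∀ q : Q, ψ q = ((q : M) : M ⧸ P) := fun q ↦ rfl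
  have hψsurj : Function.Surjective ψ := by
    intro y
    induction y using QuotientAddGroup.induction_on with
    | H m =>
      obtain ⟨m', hm'⟩ := hdiv m
      refine ⟨⟨(AddMonoidHom.id M - τ) m', m', rfl⟩, ?_⟩
      rw [hψapply, QuotientAddGroup.eq_iff_sub_mem]
      refine ⟨-m', ?_⟩
      rw [← hm']
      simp only [map_neg, AddMonoidHom.add_apply, AddMonoidHom.sub_apply, AddMonoidHom.id_apply, two_nsmul]
      abel
  have hψker2 : ∀ f ∈ ψ.ker, ((2 : ℕ) : ℤ) • f = 0 := by
    rintro ⟨c, m, rfl⟩ hf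
    rw [AddMonoidHom.mem_ker, hψapply, QuotientAddGroup.eq_zero_iff] at hf
    obtain ⟨b, hb⟩ := hf
    have hb' : b + τ b = m - τ m := by
      simpa only [AddMonoidHom.add_apply, AddMonoidHom.sub_apply, AddMonoidHom.id_apply] using hb
    have hτb : τ b + b = τ m - m := by
      have h := congrArg τ hb'
      rw [map_add, map_sub, hτ, hτ] at h
      exact h
    have hx : m - τ m = τ m - m := by rw [← hb', ← hτb, add_comm]
    apply Subtype.ext
    rw [AddSubgroupClass.coe_zsmul, ZeroMemClass.coe_zero, natCast_zsmul]
    show 2 • (AddMonoidHom.id M - τ) m = 0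
    rw [AddMonoidHom.sub_apply, AddMonoidHom.id_apply, two_nsmul]
    nth_rewrite 2 [hx]
    abel
  -- `Q[2]` is finite (inside `M[2]`)
  haveI hQfin : Finite (torsionBy Q ((2 : ℕ) : ℤ)) :=
    Finite.of_injective
      (fun x ↦ (⟨((x : Q) : M), by
          have h2 := congrArg (fun t : Q ↦ (t : M)) ((mem_torsionBy_iff' _ _).mp x.2)
          rw [mem_torsionBy_iff']
          simpa only [AddSubgroupClass.coe_zsmul, ZeroMemClass.coe_zero] using h2⟩ : torsionBy M ((2 : ℕ) : ℤ)))
      (fun a b hab ↦ Subtype.ext (Subtype.ext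
        (congrArg (fun t : torsionBy M ((2 : ℕ) : ℤ) ↦ (t : M)) hab)))
  -- Step 2 count and Step 3
  have e : Q ⧸ ψ.ker ≃+ M ⧸ P := QuotientAddGroup.quotientKerEquivOfSurjective ψ hψsurj
  have h2 : Nat.card (torsionBy (M ⧸ P) ((2 : ℕ) : ℤ)) = Nat.card (torsionBy (Q ⧸ ψ.ker) ((2 : ℕ) : ℤ)) :=
    (Nat.card_congr (torsionByEquiv e 2).toEquiv).symm
  have h3 : Nat.card (torsionBy (Q ⧸ ψ.ker) ((2 : ℕ) : ℤ)) = Nat.card (torsionBy Q ((2 : ℕ) : ℤ)) :=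
    natCard_torsionBy_quotient_eq ψ.ker ((2 : ℕ) : ℤ) hψker2 hQdiv
  rw [h1, h2, h3]


/-! ## Subgroup form: a `τ`-stable `2`-divisible subgroup `C ≤ A` -/

/-- **Eigen-rank identity, subgroup form.** For an involution `τ` of `A` and a `τ`-stable `2`-divisible subgroup `C ≤ A`
whose `2`-torsion is finite: `#(C ∩ A[2]) = #((1−τ)C ∩ A[2]) · #((1+τ)C ∩ A[2])` — `natCard_torsionBy_two_eq_mul_of_involution`
for the group `↥C` with the restricted involution, transported along the evident bijections. [folklore] -/
theorem natCard_inf_torsionBy_two_eq_mul_of_involution {A : Type*} [AddCommGroup A] (τ : A →+ A)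
    (hτ : ∀ a, τ (τ a) = a) (C : AddSubgroup A) (hC : ∀ c ∈ C, τ c ∈ C)
    (hdiv : ∀ c ∈ C, ∃ c' ∈ C, (2 : ℤ) • c' = c) [hfin : Finite ↥(C ⊓ torsionBy A ((2 : ℕ) : ℤ))] :
    Nat.card ↥(C ⊓ torsionBy A ((2 : ℕ) : ℤ)) =
      Nat.card ↥(C.map (AddMonoidHom.id A - τ) ⊓ torsionBy A ((2 : ℕ) : ℤ)) *
        Nat.card ↥(C.map (AddMonoidHom.id A + τ) ⊓ torsionBy A ((2 : ℕ) : ℤ)) := by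
  classical
  -- the restricted involution on `M := ↥C`
  set τC : C →+ C := (τ.comp C.subtype).codRestrict C (fun c ↦ hC c c.2) with hτC
  have hτC_apply : ∀ c : C, ((τC c : C) : A) = τ c := fun _ ↦ rfl
  have hτC_inv : ∀ c : C, τC (τC c) = c := fun c ↦ Subtype.ext (by rw [hτC_apply, hτC_apply, hτ])
  have hdivC : ∀ m : C, ∃ m' : C, 2 • m' = m := fun m ↦ by
    obtain ⟨c', hc', h⟩ := hdiv m m.2
    exact ⟨⟨c', hc'⟩, Subtype.ext (by rw [AddSubmonoidClass.coe_nsmul, ← h, two_nsmul, two_zsmul])⟩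
  -- (a) `C[2] ≃ C ∩ A[2]`
  have ea : Nat.card (torsionBy C ((2 : ℕ) : ℤ)) = Nat.card ↥(C ⊓ torsionBy A ((2 : ℕ) : ℤ)) := by
    refine Nat.card_congr (Equiv.ofBijective
      (fun x ↦ (⟨((x : C) : A), mem_inf.mpr ⟨(x : C).2, ?_⟩⟩ : ↥(C ⊓ torsionBy A ((2 : ℕ) : ℤ)))) ⟨?_, ?_⟩)
    · have hx := (mem_torsionBy_iff' _ _).mp x.2
      rw [mem_torsionBy_iff']
      have := congrArg (fun t : C ↦ (t : A)) hx
      simpa only [AddSubgroupClass.coe_zsmul, ZeroMemClass.coe_zero] using this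
    · intro x y hxy
      exact Subtype.ext (Subtype.ext (congrArg (fun t : ↥(C ⊓ torsionBy A ((2 : ℕ) : ℤ)) ↦ (t : A)) hxy))
    · rintro ⟨a, ha⟩
      obtain ⟨haC, ha2⟩ := mem_inf.mp ha
      refine ⟨⟨⟨a, haC⟩, (mem_torsionBy_iff' _ _).mpr (Subtype.ext ?_)⟩, rfl⟩
      rw [AddSubgroupClass.coe_zsmul, ZeroMemClass.coe_zero]
      exact (mem_torsionBy_iff' _ _).mp ha2
  haveI : Finite (torsionBy C ((2 : ℕ) : ℤ)) := Nat.finite_of_card_ne_zero (by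
    rw [ea]; exact Nat.card_pos.ne')
  -- (b) `((1 ± τC) C)[2] ≃ (1 ± τ)C ∩ A[2]` (one proof for both signs)
  have eb : ∀ (φC : C →+ C) (φ : A →+ A), (∀ c : C, ((φC c : C) : A) = φ c) →
      Nat.card (torsionBy (φC.range) ((2 : ℕ) : ℤ)) = Nat.card ↥(C.map φ ⊓ torsionBy A ((2 : ℕ) : ℤ)) := by
    intro φC φ hφ
    refine Nat.card_congr (Equiv.ofBijective
      (fun x ↦ (⟨(((x : φC.range) : C) : A), mem_inf.mpr ⟨?_, ?_⟩⟩ : ↥(C.map φ ⊓ torsionBy A ((2 : ℕ) : ℤ))))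
      ⟨?_, ?_⟩)
    · obtain ⟨m, hm⟩ := (x : φC.range).2
      exact mem_map.mpr ⟨m, m.2, by rw [← hφ, hm]⟩
    · have hx := (mem_torsionBy_iff' _ _).mp x.2
      rw [mem_torsionBy_iff']
      have := congrArg (fun t : φC.range ↦ ((t : C) : A)) hx
      simpa only [AddSubgroupClass.coe_zsmul, ZeroMemClass.coe_zero] using this
    · intro x y hxy
      have h := congrArg (fun t : ↥(C.map φ ⊓ torsionBy A ((2 : ℕ) : ℤ)) ↦ (t : A)) hxy
      exact Subtype.ext (Subtype.ext (Subtype.ext h))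
    · rintro ⟨a, ha⟩
      obtain ⟨haφ, ha2⟩ := mem_inf.mp ha
      obtain ⟨c, hc, rfl⟩ := mem_map.mp haφ
      refine ⟨⟨⟨φC ⟨c, hc⟩, ⟨⟨c, hc⟩, rfl⟩⟩, (mem_torsionBy_iff' _ _).mpr (Subtype.ext (Subtype.ext ?_))⟩,
        Subtype.ext (hφ ⟨c, hc⟩)⟩
      rw [AddSubgroupClass.coe_zsmul, AddSubgroupClass.coe_zsmul, hφ, ZeroMemClass.coe_zero, ZeroMemClass.coe_zero]
      exact (mem_torsionBy_iff' _ _).mp ha2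
  have ebm := eb (AddMonoidHom.id C - τC) (AddMonoidHom.id A - τ) (fun c ↦ by
    rw [AddMonoidHom.sub_apply, AddMonoidHom.sub_apply, AddMonoidHom.id_apply, AddMonoidHom.id_apply,
      AddSubgroupClass.coe_sub, hτC_apply])
  have ebp := eb (AddMonoidHom.id C + τC) (AddMonoidHom.id A + τ) (fun c ↦ by
    rw [AddMonoidHom.add_apply, AddMonoidHom.add_apply, AddMonoidHom.id_apply, AddMonoidHom.id_apply,
      AddSubgroup.coe_add, hτC_apply])
  rw [← ea, ← ebm, ← ebp]
  exact natCard_torsionBy_two_eq_mul_of_involution τC hτC_inv hdivC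

end Summit.BirchSwinnertonDyer.BirchSwinnertonDyer.Theorems.KolyvaginAtTwo.EigenframeFinite
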